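import Mathlib.MeasureTheory.Integral.MeanInequalities
import Literature.Analysis.FluidPDE.SobolevWholeSpace
import HarnessLib

/-!
# The multiplicative (Ladyzhenskaya / Gagliardo–Nirenberg) inequality `L² ∩ Ḣ¹ ⊂ L^{10/3}` in
  dimension three

The interpolation step of Escauriaza–Seregin–Šverák 2003, §3, (3.7) and Appendix, (7.10):
for `w` on `ℝ³`,

  `‖w‖_{L^{10/3}} ≤ C ‖w‖_{L²}^{2/5} ‖∇w‖_{L²}^{3/5}`,

by which `w = |v|^{3/2} ∈ L_{2,∞} ∩ L₂(δ, T; W¹₂)` gives `v ∈ L₅` (ESS (3.6)–(3.7) in the proof of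
Thm. 1.3; (7.9)–(7.10) in the proof of Lemma 7.1 and Thm. 7.3, the linear estimates behind Kato's
Thm. 7.4; Robinson–Rodrigo–Sadowski 2016, §16.4, p. 249). It is the composition of two facts:

* the **Hölder interpolation** `‖f‖_{10/3} ≤ ‖f‖₂^{2/5} ‖f‖₆^{3/5}` (`3/10 = (2/5)/2 + (3/5)/6`),
  valid on any measure space (`eLpNorm_ten_thirds_le_eLpNorm_two_rpow_mul_eLpNorm_six_rpow`,
  from Mathlib's `ENNReal.lintegral_mul_norm_pow_le`);
* the **Gagliardo–Nirenberg–Sobolev inequality** `‖w‖₆ ≤ K ‖∇w‖₂` in dimension `3`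
  (`1/6 = 1/2 - 1/3`), in the tree's whole-space form for `C¹` maps with `‖w‖₂ < ∞`
  (`Fluid.eLpNorm_six_le_eLpNorm_fderiv_two`, `SobolevWholeSpace`; constant
  `K = SNormLESNormFDerivOfEqConst F μ 2` of Mathlib's compactly supported case).

Everything here is proved (no named facts). The final statement
`Fluid.eLpNorm_ten_thirds_le_of_contDiff` is for `C¹` maps `w : E → F` on a `3`-dimensional real
inner product space `E` with an additive Haar measure and `w ∈ L²` — exactly the class in which
ESS apply (7.10) ("we may assume `a ∈ C₀^∞`. Then, all further operations will be obviously
legal", (7.7)); the `W¹₂` version follows by density once Sobolev functions on `ℝ³` are available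
and is not stated here. `Fluid.eLpNorm_ten_thirds_le_of_contDiff_euclidean` is the specialisation
to `ℝ³ = EuclideanSpace ℝ (Fin 3)` with Lebesgue measure.

## Mathlib search

Mathlib (this pin) has Hölder's inequality for lower Lebesgue integrals
(`ENNReal.lintegral_mul_le_Lp_mul_Lq`, `ENNReal.lintegral_mul_norm_pow_le`) and the GNS
inequality for `C¹_c` maps (`MeasureTheory.eLpNorm_le_eLpNorm_fderiv_of_eq`), but no
Gagliardo–Nirenberg interpolation inequality between `L²`, `Ḣ¹` and `L^{10/3}` (searched
`Nirenberg`, `interpolation` in `MeasureTheory/Function`, `ten_thirds`: none).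

## References

* L. Escauriaza, G. Seregin, V. Šverák, *`L_{3,∞}`-solutions of Navier–Stokes equations and
  backward uniqueness*, Uspekhi Mat. Nauk 58:2 (2003) 3–44 = Russ. Math. Surveys 58:2 (2003)
  211–250, §3, (3.7); Appendix, (7.10).
* O. A. Ladyzhenskaya, V. A. Solonnikov, N. N. Ural'ceva, *Linear and quasilinear equations of
  parabolic type* (AMS 1968), Ch. II, §3, (3.1) (multiplicative inequalities; ESS's ref. [18]).
* J. C. Robinson, J. L. Rodrigo, W. Sadowski, *The three-dimensional Navier–Stokes equations*
  (CUP 2016), §16.4, p. 249.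
-/

noncomputable section

open MeasureTheory Set Function Filter Topology Module
open scoped ENNReal NNReal

namespace Literature.Analysis.FluidPDE

section Interp

variable {α : Type*} [MeasurableSpace α] {μ : Measure α}
variable {F : Type*} [NormedAddCommGroup F]

/-- **Hölder interpolation at the level of integrals**: `∫ |f|^{10/3} ≤ (∫ |f|²)^{2/3} (∫ |f|⁶)^{1/3}`
(`|f|^{10/3} = (|f|²)^{2/3} · (|f|⁶)^{1/3}` and Hölder with exponents `3/2`, `3`; the integral form
of ESS 2003, (3.7)/(7.10) before Sobolev). [folklore] -/
theorem lintegral_enorm_rpow_ten_thirds_le {f : α → F} (hf : AEStronglyMeasurable f μ) :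
    ∫⁻ a, ‖f a‖ₑ ^ (10 / 3 : ℝ) ∂μ ≤
      (∫⁻ a, ‖f a‖ₑ ^ (2 : ℝ) ∂μ) ^ (2 / 3 : ℝ) * (∫⁻ a, ‖f a‖ₑ ^ (6 : ℝ) ∂μ) ^ (1 / 3 : ℝ) := by
  have hm : AEMeasurable (fun a => ‖f a‖ₑ) μ := hf.enorm
  have h := ENNReal.lintegral_mul_norm_pow_le (hm.pow_const (2 : ℝ)) (hm.pow_const (6 : ℝ))
    (p := 2 / 3) (q := 1 / 3) (by norm_num) (by norm_num) (by norm_num)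
  refine le_trans (le_of_eq (lintegral_congr fun a => ?_)) h
  rw [← ENNReal.rpow_mul, ← ENNReal.rpow_mul, ← ENNReal.rpow_add_of_nonneg _ _ (by norm_num)
    (by norm_num)]
  norm_num

/-- **Hölder interpolation between `L²` and `L⁶`**: `‖f‖_{L^{10/3}} ≤ ‖f‖_{L²}^{2/5} ‖f‖_{L⁶}^{3/5}`
on any measure space, for a.e. strongly measurable `f` (`3/10 = (2/5)·(1/2) + (3/5)·(1/6)`;
Robinson–Rodrigo–Sadowski 2016, §16.4, p. 249: "interpolating between `L^∞_t L³_x` and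
`L²_t L⁶_x`" is the same computation). Norms in `ℝ≥0∞`. [folklore] -/
theorem eLpNorm_ten_thirds_le_eLpNorm_two_rpow_mul_eLpNorm_six_rpow {f : α → F}
    (hf : AEStronglyMeasurable f μ) :
    eLpNorm f (10 / 3) μ ≤ eLpNorm f 2 μ ^ (2 / 5 : ℝ) * eLpNorm f 6 μ ^ (3 / 5 : ℝ) := by
  have h103 : (10 / 3 : ℝ≥0∞) = ((10 / 3 : ℝ≥0) : ℝ≥0∞) := by
    rw [ENNReal.coe_div (by norm_num)]; norm_num
  have e103 : eLpNorm f (10 / 3) μ = (∫⁻ a, ‖f a‖ₑ ^ (10 / 3 : ℝ) ∂μ) ^ (3 / 10 : ℝ) := by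
    rw [h103, eLpNorm_nnreal_eq_lintegral (by norm_num)]
    norm_num
  have e2 : eLpNorm f 2 μ = (∫⁻ a, ‖f a‖ₑ ^ (2 : ℝ) ∂μ) ^ (1 / 2 : ℝ) := by
    rw [show (2 : ℝ≥0∞) = ((2 : ℝ≥0) : ℝ≥0∞) by norm_num, eLpNorm_nnreal_eq_lintegral (by norm_num)]
    norm_num
  have e6 : eLpNorm f 6 μ = (∫⁻ a, ‖f a‖ₑ ^ (6 : ℝ) ∂μ) ^ (1 / 6 : ℝ) := by
    rw [show (6 : ℝ≥0∞) = ((6 : ℝ≥0) : ℝ≥0∞) by norm_num, eLpNorm_nnreal_eq_lintegral (by norm_num)]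
    norm_num
  rw [e103, e2, e6, ← ENNReal.rpow_mul, ← ENNReal.rpow_mul]
  calc (∫⁻ a, ‖f a‖ₑ ^ (10 / 3 : ℝ) ∂μ) ^ (3 / 10 : ℝ)
      ≤ ((∫⁻ a, ‖f a‖ₑ ^ (2 : ℝ) ∂μ) ^ (2 / 3 : ℝ) *
          (∫⁻ a, ‖f a‖ₑ ^ (6 : ℝ) ∂μ) ^ (1 / 3 : ℝ)) ^ (3 / 10 : ℝ) :=
        ENNReal.rpow_le_rpow (lintegral_enorm_rpow_ten_thirds_le hf) (by norm_num)
    _ = (∫⁻ a, ‖f a‖ₑ ^ (2 : ℝ) ∂μ) ^ (1 / 2 * (2 / 5) : ℝ) *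
          (∫⁻ a, ‖f a‖ₑ ^ (6 : ℝ) ∂μ) ^ (1 / 6 * (3 / 5) : ℝ) := by
        rw [ENNReal.mul_rpow_of_nonneg _ _ (by norm_num), ← ENNReal.rpow_mul, ← ENNReal.rpow_mul]
        norm_num

end Interp

section GNS

variable {E : Type*} [NormedAddCommGroup E] [InnerProductSpace ℝ E] [FiniteDimensional ℝ E]
  [MeasurableSpace E] [BorelSpace E]
variable {F : Type*} [NormedAddCommGroup F] [NormedSpace ℝ F] [FiniteDimensional ℝ F]

/-- **The multiplicative inequality (ESS 2003, (3.7) = (7.10))** on a `3`-dimensional real inner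
product space `E` with an additive Haar measure `μ`: for every `C¹` map `w : E → F` with
`w ∈ L²(μ)`,
`‖w‖_{L^{10/3}} ≤ K^{3/5} ‖w‖_{L²}^{2/5} ‖Dw‖_{L²}^{3/5}`, `K = SNormLESNormFDerivOfEqConst F μ 2` the
Gagliardo–Nirenberg–Sobolev constant (Ladyzhenskaya–Solonnikov–Ural'ceva, Ch. II, §3, (3.1);
Robinson–Rodrigo–Sadowski 2016, p. 249). Real proof: Hölder interpolation
`eLpNorm_ten_thirds_le_eLpNorm_two_rpow_mul_eLpNorm_six_rpow` and the whole-space Sobolev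
embedding `Fluid.eLpNorm_six_le_eLpNorm_fderiv_two` (`H¹ ⊂ L⁶`, where `w ∈ L²` excludes the
constants). [cite: EscauriazaSereginSverak2003, (3.7) and (7.10)] -/
theorem eLpNorm_ten_thirds_le_of_contDiff (μ : Measure E) [μ.IsAddHaarMeasure]
    (hE : finrank ℝ E = 3) {w : E → F} (hw : ContDiff ℝ 1 w) (hw2 : eLpNorm w 2 μ < ∞) :
    eLpNorm w (10 / 3) μ ≤
      (SNormLESNormFDerivOfEqConst F μ 2 : ℝ≥0∞) ^ (3 / 5 : ℝ) *
        eLpNorm w 2 μ ^ (2 / 5 : ℝ) * eLpNorm (fderiv ℝ w) 2 μ ^ (3 / 5 : ℝ) := by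
  have h1 := eLpNorm_ten_thirds_le_eLpNorm_two_rpow_mul_eLpNorm_six_rpow (μ := μ)
    hw.continuous.aestronglyMeasurable
  have h2 : eLpNorm w 6 μ ^ (3 / 5 : ℝ) ≤
      (SNormLESNormFDerivOfEqConst F μ 2 : ℝ≥0∞) ^ (3 / 5 : ℝ) *
        eLpNorm (fderiv ℝ w) 2 μ ^ (3 / 5 : ℝ) := by
    rw [← ENNReal.mul_rpow_of_nonneg _ _ (by norm_num)]
    exact ENNReal.rpow_le_rpow (eLpNorm_six_le_eLpNorm_fderiv_two μ hE hw hw2) (by norm_num)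
  calc eLpNorm w (10 / 3) μ
      ≤ eLpNorm w 2 μ ^ (2 / 5 : ℝ) * eLpNorm w 6 μ ^ (3 / 5 : ℝ) := h1
    _ ≤ eLpNorm w 2 μ ^ (2 / 5 : ℝ) *
        ((SNormLESNormFDerivOfEqConst F μ 2 : ℝ≥0∞) ^ (3 / 5 : ℝ) *
          eLpNorm (fderiv ℝ w) 2 μ ^ (3 / 5 : ℝ)) := by gcongr
    _ = _ := by ring

/-- **The multiplicative inequality on `ℝ³`** (ESS 2003, (3.7) = (7.10)), Lebesgue measure on
`ℝ³ = EuclideanSpace ℝ (Fin 3)`: for every `C¹` map `w : ℝ³ → F` with `w ∈ L²`,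
`‖w‖_{L^{10/3}} ≤ K^{3/5} ‖w‖_{L²}^{2/5} ‖Dw‖_{L²}^{3/5}` (specialisation of
`eLpNorm_ten_thirds_le_of_contDiff`, `finrank ℝ ℝ³ = 3`). [cite: EscauriazaSereginSverak2003, (3.7) and (7.10)] -/
theorem eLpNorm_ten_thirds_le_of_contDiff_euclidean {w : EuclideanSpace ℝ (Fin 3) → F}
    (hw : ContDiff ℝ 1 w) (hw2 : eLpNorm w 2 volume < ∞) :
    eLpNorm w (10 / 3) volume ≤
      (SNormLESNormFDerivOfEqConst F (volume : Measure (EuclideanSpace ℝ (Fin 3))) 2 : ℝ≥0∞) ^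
          (3 / 5 : ℝ) *
        eLpNorm w 2 volume ^ (2 / 5 : ℝ) * eLpNorm (fderiv ℝ w) 2 volume ^ (3 / 5 : ℝ) :=
  eLpNorm_ten_thirds_le_of_contDiff volume finrank_euclideanSpace_fin hw hw2

end GNS

end Literature.Analysis.FluidPDE
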